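import Summits.QuantumFields.YangMills.Theorems.BalabanUVNodesN19LawIncrementsTarget
import Mathlib.Analysis.SpecialFunctions.Trigonometric.Chebyshev.Extremal

/-!
# YM-DAG node N19 (= NE7 proper) — THE ALTERNATING CHEBYSHEV-ARC FUNCTIONAL (part 1 of the complementary-arc laws): it kills every polynomial of
# degree `≤ n−2` and sees `e^{tx}` only through `4l₀^{n−1}∕(n−1)!` on the window

Cell `pub-ymgap`, HUMAN RULING D-0062 (Track A) ∕ D-0149 (work-bound push), R141 (C) wider-strategy seat `pub-ymgap-dag-n19-e` (strategy s3 =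
ALTERNATIVE CURRENCY), generation g21, module 8 (lineage module 71; part 2 = module 72 `…N19ChebyshevArcLaws`, the sequence = module 73 `…N19TargetNotLawSummableSharp`).  Route `Summits/QuantumFields/YangMills/Theses/BalabanUVNodes.lean` rev 25,
cluster item K3⁷ «SpineGivenEndpointR13SepCoPH» (stmt-QuantumFields-20544); filed `--supports` that item `--as helper` (it proves no registered
stub).  COUNT-NEUTRAL: [folklore] real analysis over Mathlib (Chebyshev polynomials `T`, `U`, the extremal nodes `node n k = cos(kπ∕n)`,
`Complex.exp_bound'`) + module 59 `…N19DiscreteJackson` (`sum_cos_add_int_mul_node`: full-period discrete orthogonality) and module 64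
(`abs_log_sub_log_le_of_exp_neg_le`, `exp_neg_le_mgf_id_of_Icc_symm`) BY NAME; no scheme object, no Theses import; NOT a discharge claim.

WHY.  Module 68's strictness witness («`Target` ⇏ summable law increments») dilutes p543481's binomial pairs into ONE mixture and therefore has only
POLYNOMIALLY decaying window remainders; module 70's header left the GEOMETRIC case (the programme's) open.  The obstruction was the lack of a COMMON
BASE carrying the extremal pairs of all levels at full amplitude.  This file builds such a family.

THE CONSTRUCTION (Chebyshev's perfect spline ∕ Favard's extremal, as laws).  Nodes `x_k = cos(kπ∕n)` (`k = 0,…,n`; Mathlib `Polynomial.Chebyshev.node`),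
arcs `I_k = (x_{k+1}, x_k]` partitioning `(−1, 1]`; `P_n` = Lebesgue measure on the EVEN arcs, `Q_n` = Lebesgue measure on the ODD arcs.  §1 THE
DISCRETE IDENTITY `Σ_{k<n} (−1)^k (x_k^m − x_{k+1}^m) = 0` for `1 ≤ m ≤ n−1` (`alternatingNode_pow_sub_eq_zero`): power reduction
`2^m cos^m α = Σ_i C(m,i) cos((m−2i)α)` (`two_pow_mul_cos_pow`), `(−1)^k cos(a kπ∕n) = cos((a+n)kπ∕n)`, and the HALF-END sum
`Σ_{k<n} cos(akπ∕n) + Σ_{k<n} cos(a(k+1)π∕n) = Σ_{k<2n} cos(akπ∕n) = 0` for `2n ∤ a` (`sum_cos_halfEnds_eq_zero`, module 59's full period folded by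
`k ↦ 2n − k`).  §2 THE LAWS: both have mass `1` (the identity at `m = 1` + telescoping `Σ L_k = 2`), are carried by `[−1,1]`, and
`∫f dP_n − ∫f dQ_n = Σ_{k<n} (−1)^k ∫_{x_{k+1}}^{x_k} f` (`arcLaws_integral_sub`); hence EQUAL MOMENTS `j ≤ n−2` (`integral_pow` + §1) and, writing
`e^{tx}` = Taylor polynomial of degree `n−2` + remainder (`Complex.exp_bound'`, `n ≥ 2l₀`), ★ `|mgf Q_n t − mgf P_n t| ≤ 4l₀^{n−1}∕(n−1)!` on `|t| ≤ l₀`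
and ★ `|cgf Q_n t − cgf P_n t| ≤ 4e^{l₀}l₀^{n−1}∕(n−1)!` (module 64's log-Lipschitz lemma).  §3 THE GAP: the polynomial
`g_n = (1 − x²)U_{n−1}(x)∕(2n) = (xT_n − T_{n+1})∕(2n)` (`= sin nθ·sin θ∕(2n)` at `x = cos θ`) is `1`-Lipschitz and `½`-bounded on `[−1,1]`
(`g_n′ = −(nT_n + xU_{n−1})∕(2n)`, Mathlib's `(1 − X²)U′` identity, `|T_n| ≤ 1`, `|U_{n−1}| ≤ n` from `|sin nθ| ≤ n sin θ`), has antiderivative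
`G_n = (T_n∕(2n) − T_{n+2}∕(4(n+2)) − T_{n−2}∕(4(n−2)))∕(2n)·…` with `T_n(x_k) = (−1)^k`, `T_{n±2}(x_k) = (−1)^k cos(2kπ∕n)`, so by §1's half-end sum
★★ `∫g_n dP_n − ∫g_n dQ_n = 1∕(2n)` EXACTLY (`arcLaws_gap`).  ★★ `exists_chebyshevArc_laws` packages the level-`n` pair.
The sibling module 72 runs the levels `n_K = K + N` into ONE sequence: window-cgf increments `≤ 8e^{l₀}l₀^{K+N−1}∕(K+N−1)!` (faster than any
geometric sequence) with bounded-Lipschitz increments `≥ 1∕(2(K+N+1))` — not summable.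

HONEST FRAMING (binding).  Elementary and [folklore] (the alternating Chebyshev-arc measure annihilates polynomials of degree `≤ n−2`: Chebyshev ∕
Favard ∕ perfect splines); toy laws, no scheme object; NO consumer in the DAG today (a structural statement about the seat's own currencies); nothing of
Bałaban's instantiated; NE7 NOT PRINTED, NOT proved; N19 NOT discharged; count-neutral.  One finite `T⁴` programme at fixed `ε`; nothing continuum ∕
`ℝ⁴` ∕ OS ∕ mass-gap ∕ Clay.  0 `def` ∕ 0 `sorry`.
-/

noncomputable section

open Real Finset MeasureTheory ProbabilityTheory Polynomial.Chebyshev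

namespace Summit.QuantumFields.YangMills.Theorems.BalabanUVNodesN19ChebyshevArcFunctional

open Summit.QuantumFields.YangMills.Theorems.BalabanUVNodesN19DiscreteJackson (sum_cos_add_int_mul_node)
open Summit.QuantumFields.YangMills.Theorems.BalabanUVNodesN19LawIncrementsTarget (abs_log_sub_log_le_of_exp_neg_le exp_neg_le_mgf_id_of_Icc_symm)

/-! ## §1 The discrete identity `Σ_{k<n} (−1)^k (x_k^m − x_{k+1}^m) = 0`, `1 ≤ m ≤ n−1` [folklore] -/

/-- **POWER REDUCTION**: `2^m cos^m α = Σ_{i=0}^{m} C(m,i)·cos((2i − m)α)` (binomial expansion of `(e^{iα} + e^{−iα})^m`, real parts). [folklore] -/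
theorem two_pow_mul_cos_pow (m : ℕ) (α : ℝ) :
    (2 : ℝ) ^ m * Real.cos α ^ m = ∑ i ∈ range (m + 1), (m.choose i : ℝ) * Real.cos ((2 * (i : ℝ) - m) * α) := by
  -- complex form
  have hc : ((2 : ℂ) * Complex.cos α) ^ m = ∑ i ∈ range (m + 1), (m.choose i : ℂ) * Complex.exp (((2 * (i : ℝ) - m) * α : ℝ) * Complex.I) := by
    rw [Complex.two_cos, add_pow]
    refine Finset.sum_congr rfl fun i hi => ?_
    have him : i ≤ m := Nat.lt_succ_iff.1 (Finset.mem_range.1 hi)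
    rw [mul_comm, ← Complex.exp_nat_mul, ← Complex.exp_nat_mul, ← Complex.exp_add]
    congr 1
    push_cast
    rw [Nat.cast_sub him]
    ring
  have hre := congrArg Complex.re hc
  rw [Complex.re_sum] at hre
  have hl : (((2 : ℂ) * Complex.cos α) ^ m).re = (2 : ℝ) ^ m * Real.cos α ^ m := by
    rw [← Complex.ofReal_cos, ← Complex.ofReal_ofNat, ← Complex.ofReal_mul, ← Complex.ofReal_pow, Complex.ofReal_re, mul_pow]
  rw [hl] at hre
  rw [hre]
  refine Finset.sum_congr rfl fun i _ => ?_
  rw [← Complex.ofReal_natCast, Complex.re_ofReal_mul, Complex.exp_ofReal_mul_I_re]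

/-- **THE HALF-END SUM**: for `n ≥ 1` and an integer `a` with `2n ∤ a`, `Σ_{k<n} cos(akπ∕n) + Σ_{k<n} cos(a(k+1)π∕n) = 0` — the full period
`Σ_{k<2n} cos(akπ∕n) = 0` (module 59's `sum_cos_add_int_mul_node` with `N = 2n`) folded by `k ↦ 2n − 1 − k` on its second half. [folklore] -/
theorem sum_cos_halfEnds_eq_zero {n : ℕ} (hn : n ≠ 0) {a : ℤ} (ha : ¬ ((2 * n : ℕ) : ℤ) ∣ a) :
    ∑ k ∈ range n, Real.cos (a * k * π / n) + ∑ k ∈ range n, Real.cos (a * (k + 1) * π / n) = 0 := by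
  have h2n : 2 * n ≠ 0 := by omega
  have hfull := sum_cos_add_int_mul_node h2n ha 0
  have hnr : (n : ℝ) ≠ 0 := Nat.cast_ne_zero.2 hn
  -- the summand of the full period, in our normal form
  have hterm : ∀ k : ℕ, Real.cos (0 + a * (2 * π * k / (2 * n : ℕ))) = Real.cos (a * k * π / n) := fun k => by
    congr 1; push_cast; field_simp; ring
  simp_rw [hterm] at hfull
  rw [two_mul, Finset.sum_range_add] at hfull
  -- fold the second half: `k ↦ n − 1 − k`, `cos(a(2n − 1 − k)π∕n) = cos(2aπ − a(k+1)π∕n) = cos(a(k+1)π∕n)`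
  have hsecond : ∑ k ∈ range n, Real.cos (a * ((n + k : ℕ) : ℝ) * π / n) = ∑ k ∈ range n, Real.cos (a * (k + 1) * π / n) := by
    rw [← Finset.sum_range_reflect (fun k => Real.cos (a * (k + 1) * π / n)) n]
    refine Finset.sum_congr rfl fun k hk => ?_
    have hkn : k < n := Finset.mem_range.1 hk
    have e : (a : ℝ) * ((n + k : ℕ) : ℝ) * π / n = a * (2 * π) - a * (((n - 1 - k : ℕ) : ℝ) + 1) * π / n := by
      rw [Nat.cast_sub (by omega : k ≤ n - 1), Nat.cast_sub (by omega : 1 ≤ n)]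
      push_cast
      field_simp
      ring
    rw [e, Real.cos_int_mul_two_pi_sub]
  rw [hsecond] at hfull
  exact hfull

/-- `(−1)^k cos(bkπ∕n) = cos((b+n)kπ∕n)` (`cos(x + kπ) = (−1)^k cos x`). [bookkeeping] -/
theorem negOnePow_mul_cos_node (b : ℤ) (n k : ℕ) (hn : n ≠ 0) :
    (-1 : ℝ) ^ k * Real.cos (b * k * π / n) = Real.cos ((b + n) * k * π / n) := by
  have hnr : (n : ℝ) ≠ 0 := Nat.cast_ne_zero.2 hn
  have e : ((b : ℝ) + n) * k * π / n = b * k * π / n + k * π := by field_simp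
  rw [e]
  exact (Real.cos_add_nat_mul_pi _ _).symm

/-- **★ THE DISCRETE IDENTITY**: for `n ≥ 1` and `1 ≤ m ≤ n − 1`, with the Chebyshev extrema `x_k = cos(kπ∕n)`,
`Σ_{k<n} (−1)^k (x_k^m − x_{k+1}^m) = 0` — power reduction turns `(−1)^k x_k^m` into `2^{−m}Σ_i C(m,i) cos((2i−m+n)kπ∕n)`, and `2i − m + n ∈ [1, 2n−1]`
is never a multiple of `2n`, so every half-end sum vanishes.  (Equivalently: the alternating arc functional kills `T_1, …, T_{n−1}`.) [folklore] -/
theorem alternatingNode_pow_sub_eq_zero {n m : ℕ} (hm1 : 1 ≤ m) (hmn : m + 1 ≤ n) :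
    ∑ k ∈ range n, (-1 : ℝ) ^ k * (Real.cos (k * π / n) ^ m - Real.cos ((k + 1) * π / n) ^ m) = 0 := by
  have hn : n ≠ 0 := by omega
  -- multiply by `2^m` and reduce powers
  have h2 : (2 : ℝ) ^ m ≠ 0 := pow_ne_zero _ two_ne_zero
  rw [← mul_right_inj' h2, mul_zero, Finset.mul_sum]
  have hred : ∀ k : ℕ, (2 : ℝ) ^ m * ((-1 : ℝ) ^ k * (Real.cos (k * π / n) ^ m - Real.cos ((k + 1) * π / n) ^ m)) =
      ∑ i ∈ range (m + 1), (m.choose i : ℝ) *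
        (Real.cos (((2 * (i : ℤ) - m : ℤ) + n) * k * π / n) + Real.cos (((2 * (i : ℤ) - m : ℤ) + n) * (k + 1) * π / n)) := by
    intro k
    have hk := two_pow_mul_cos_pow m (k * π / n)
    have hk1 := two_pow_mul_cos_pow m ((k + 1) * π / n)
    -- the two shifted cosines
    have e1 : ∀ i : ℕ, (-1 : ℝ) ^ k * Real.cos ((2 * (i : ℝ) - m) * (k * π / n)) =
        Real.cos (((2 * (i : ℤ) - m : ℤ) + n) * k * π / n) := fun i => by
      have h := negOnePow_mul_cos_node (2 * (i : ℤ) - m) n k hn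
      push_cast at h ⊢
      rw [← h]
      congr 2
      ring
    have e2 : ∀ i : ℕ, (-1 : ℝ) ^ k * Real.cos ((2 * (i : ℝ) - m) * ((k + 1) * π / n)) =
        -Real.cos (((2 * (i : ℤ) - m : ℤ) + n) * (k + 1) * π / n) := fun i => by
      have h := negOnePow_mul_cos_node (2 * (i : ℤ) - m) n (k + 1) hn
      rw [pow_succ] at h
      push_cast at h ⊢
      have e : Real.cos ((2 * (i : ℝ) - m) * ((k + 1) * π / n)) = Real.cos ((2 * (i : ℝ) - m) * (k + 1) * π / n) := by
        congr 1; ring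
      rw [e]
      linear_combination (-1 : ℝ) * h
    calc (2 : ℝ) ^ m * ((-1 : ℝ) ^ k * (Real.cos (k * π / n) ^ m - Real.cos ((k + 1) * π / n) ^ m))
        = (-1 : ℝ) ^ k * ((2 : ℝ) ^ m * Real.cos (k * π / n) ^ m) - (-1 : ℝ) ^ k * ((2 : ℝ) ^ m * Real.cos ((k + 1) * π / n) ^ m) := by
          ring
      _ = (-1 : ℝ) ^ k * ∑ i ∈ range (m + 1), (m.choose i : ℝ) * Real.cos ((2 * (i : ℝ) - m) * (k * π / n)) -
            (-1 : ℝ) ^ k * ∑ i ∈ range (m + 1), (m.choose i : ℝ) * Real.cos ((2 * (i : ℝ) - m) * ((k + 1) * π / n)) := by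
          rw [hk, hk1]
      _ = ∑ i ∈ range (m + 1), ((m.choose i : ℝ) * ((-1 : ℝ) ^ k * Real.cos ((2 * (i : ℝ) - m) * (k * π / n))) -
            (m.choose i : ℝ) * ((-1 : ℝ) ^ k * Real.cos ((2 * (i : ℝ) - m) * ((k + 1) * π / n)))) := by
          rw [Finset.mul_sum, Finset.mul_sum, ← Finset.sum_sub_distrib]
          refine Finset.sum_congr rfl fun i _ => ?_
          ring
      _ = _ := by
          refine Finset.sum_congr rfl fun i _ => ?_
          rw [e1 i, e2 i]
          ring
  simp_rw [hred]
  rw [Finset.sum_comm]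
  refine Finset.sum_eq_zero fun i hi => ?_
  have him : i ≤ m := Nat.lt_succ_iff.1 (Finset.mem_range.1 hi)
  rw [← Finset.mul_sum, Finset.sum_add_distrib]
  have ha : ¬ ((2 * n : ℕ) : ℤ) ∣ ((2 * (i : ℤ) - m : ℤ) + n) := by
    intro hd
    have h0 : (0 : ℤ) < (2 * (i : ℤ) - m : ℤ) + n := by omega
    have h1 : ((2 * (i : ℤ) - m : ℤ) + n) < ((2 * n : ℕ) : ℤ) := by push_cast; omega
    obtain ⟨c, hc⟩ := hd
    have hc0 : 0 < c := by
      by_contra h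
      have h' : c ≤ 0 := not_lt.1 h
      have : ((2 * n : ℕ) : ℤ) * c ≤ 0 := mul_nonpos_of_nonneg_of_nonpos (by positivity) h'
      omega
    have : ((2 * n : ℕ) : ℤ) * 1 ≤ ((2 * n : ℕ) : ℤ) * c := mul_le_mul_of_nonneg_left hc0 (by positivity)
    omega
  have h := sum_cos_halfEnds_eq_zero hn ha
  push_cast at h ⊢
  rw [h, mul_zero]

/-! ## §2 The arcs between consecutive Chebyshev extrema and the alternating arc functional [folklore] -/

/-- Consecutive extrema decrease: `x_{k+1} < x_k` for `k < n`. [bookkeeping] -/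
theorem node_succ_lt {n k : ℕ} (hk : k < n) : node n (k + 1) < node n k :=
  node_lt (by omega) (Nat.lt_succ_self k)

/-- The arcs have total length `2` (`x_0 − x_n = 1 − (−1)`). [bookkeeping] -/
theorem sum_arcLength {n : ℕ} (hn : n ≠ 0) : ∑ k ∈ range n, (node n k - node n (k + 1)) = 2 := by
  rw [Finset.sum_range_sub', node_eq_one, node_eq_neg_one hn]; norm_num

/-- The alternating sum of the arc lengths vanishes (§1 at `m = 1`; `n ≥ 2`). [bookkeeping] -/
theorem alt_sum_arcLength {n : ℕ} (hn : 2 ≤ n) : ∑ k ∈ range n, (-1 : ℝ) ^ k * (node n k - node n (k + 1)) = 0 := by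
  have h := alternatingNode_pow_sub_eq_zero (n := n) (m := 1) le_rfl hn
  simpa only [node, pow_one, Nat.cast_add, Nat.cast_one] using h

/-- The even arcs and the odd arcs each have total length `1`. [bookkeeping] -/
theorem sum_arcLength_even_odd {n : ℕ} (hn : 2 ≤ n) :
    ∑ k ∈ (range n).filter (fun k => Even k), (node n k - node n (k + 1)) = 1 ∧
      ∑ k ∈ (range n).filter (fun k => ¬ Even k), (node n k - node n (k + 1)) = 1 := by
  have h2 := sum_arcLength (n := n) (by omega)
  have h0 := alt_sum_arcLength hn
  rw [← Finset.sum_filter_add_sum_filter_not (range n) (fun k => Even k)] at h2 h0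
  have he : ∑ k ∈ (range n).filter (fun k => Even k), (-1 : ℝ) ^ k * (node n k - node n (k + 1)) =
      ∑ k ∈ (range n).filter (fun k => Even k), (node n k - node n (k + 1)) :=
    Finset.sum_congr rfl fun k hk => by rw [(Finset.mem_filter.1 hk).2.neg_one_pow, one_mul]
  have ho : ∑ k ∈ (range n).filter (fun k => ¬ Even k), (-1 : ℝ) ^ k * (node n k - node n (k + 1)) =
      -∑ k ∈ (range n).filter (fun k => ¬ Even k), (node n k - node n (k + 1)) := by
    rw [← Finset.sum_neg_distrib]
    exact Finset.sum_congr rfl fun k hk => by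
      rw [(Nat.not_even_iff_odd.1 (Finset.mem_filter.1 hk).2).neg_one_pow]; ring
  rw [he, ho] at h0
  constructor <;> linarith

/-- **EQUAL MOMENTS**: the alternating arc functional kills `x^j` for `j + 2 ≤ n` (`integral_pow` + §1 at `m = j + 1`). [folklore] -/
theorem alt_sum_integral_pow_eq_zero {n j : ℕ} (hj : j + 2 ≤ n) :
    ∑ k ∈ range n, (-1 : ℝ) ^ k * ∫ x in node n (k + 1)..node n k, x ^ j = 0 := by
  simp_rw [integral_pow]
  have h := alternatingNode_pow_sub_eq_zero (n := n) (m := j + 1) (by omega) (by omega)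
  have hj0 : ((j : ℝ) + 1) ≠ 0 := by positivity
  have e : ∀ k : ℕ, (-1 : ℝ) ^ k * ((node n k ^ (j + 1) - node n (k + 1) ^ (j + 1)) / (j + 1)) =
      (1 / ((j : ℝ) + 1)) * ((-1 : ℝ) ^ k * (Real.cos (k * π / n) ^ (j + 1) - Real.cos ((k + 1) * π / n) ^ (j + 1))) := fun k => by
    simp only [node, Nat.cast_add, Nat.cast_one]; field_simp
  simp_rw [e]
  rw [← Finset.mul_sum, h, mul_zero]

/-- The alternating arc functional kills every polynomial of degree `≤ n − 2` written as a finite power sum. [folklore] -/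
theorem alt_sum_integral_powSum_eq_zero {n d : ℕ} (hd : d + 1 ≤ n) (c : ℕ → ℝ) :
    ∑ k ∈ range n, (-1 : ℝ) ^ k * ∫ x in node n (k + 1)..node n k, ∑ j ∈ range d, c j * x ^ j = 0 := by
  have hint : ∀ k : ℕ, ∫ x in node n (k + 1)..node n k, ∑ j ∈ range d, c j * x ^ j =
      ∑ j ∈ range d, c j * ∫ x in node n (k + 1)..node n k, x ^ j := fun k => by
    rw [intervalIntegral.integral_finsetSum fun j _ => ?_]
    · exact Finset.sum_congr rfl fun j _ => intervalIntegral.integral_const_mul _ _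
    · exact (continuous_const.mul (continuous_pow j)).intervalIntegrable _ _
  simp_rw [hint, Finset.mul_sum]
  rw [Finset.sum_comm]
  refine Finset.sum_eq_zero fun j hj => ?_
  have hjd : j < d := Finset.mem_range.1 hj
  have e : ∀ k : ℕ, (-1 : ℝ) ^ k * (c j * ∫ x in node n (k + 1)..node n k, x ^ j) =
      c j * ((-1 : ℝ) ^ k * ∫ x in node n (k + 1)..node n k, x ^ j) := fun k => by ring
  simp_rw [e]
  rw [← Finset.mul_sum, alt_sum_integral_pow_eq_zero (by omega), mul_zero]

/-- **THE EXPONENTIAL MINUS ITS TAYLOR POLYNOMIAL OF DEGREE `n − 2`** on `[−1,1]` for `|t| ≤ l₀` and `2l₀ ≤ n`: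
`|e^{tx} − Σ_{j<n−1} (tx)^j∕j!| ≤ 2·l₀^{n−1}∕(n−1)!` (Mathlib's `Complex.exp_bound'`, real parts). [folklore] -/
theorem abs_exp_sub_taylor_le {n : ℕ} {l₀ t x : ℝ} (hn : 2 * l₀ ≤ n) (hn1 : 1 ≤ n) (ht : |t| ≤ l₀) (hx : |x| ≤ 1) :
    |Real.exp (t * x) - ∑ j ∈ range (n - 1), (t * x) ^ j / (j.factorial : ℝ)| ≤ 2 * (l₀ ^ (n - 1) / ((n - 1).factorial : ℝ)) := by
  have hl₀ : 0 ≤ l₀ := (abs_nonneg _).trans ht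
  have htx : |t * x| ≤ l₀ := by rw [abs_mul]; nlinarith [abs_nonneg t, abs_nonneg x]
  have hnr : (((n - 1 : ℕ) : ℝ) + 1) = n := by rw [Nat.cast_sub hn1]; push_cast; ring
  have hyp : ‖((t * x : ℝ) : ℂ)‖ / ((n - 1).succ : ℕ) ≤ 1 / 2 := by
    rw [Complex.norm_real, Real.norm_eq_abs, Nat.succ_eq_add_one, Nat.sub_add_cancel hn1]
    rw [div_le_div_iff₀ (by exact_mod_cast hn1) two_pos]
    linarith
  have h := Complex.exp_bound' (x := ((t * x : ℝ) : ℂ)) (n := n - 1) hyp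
  rw [Complex.norm_real, Real.norm_eq_abs] at h
  -- real parts
  have hre : (Complex.exp ((t * x : ℝ) : ℂ) - ∑ m ∈ range (n - 1), ((t * x : ℝ) : ℂ) ^ m / (m.factorial : ℂ)).re =
      Real.exp (t * x) - ∑ j ∈ range (n - 1), (t * x) ^ j / (j.factorial : ℝ) := by
    rw [Complex.sub_re, ← Complex.ofReal_exp, Complex.ofReal_re, Complex.re_sum]
    congr 1
    refine Finset.sum_congr rfl fun j _ => ?_
    rw [← Complex.ofReal_pow, ← Complex.ofReal_natCast, ← Complex.ofReal_div, Complex.ofReal_re]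
  rw [← hre]
  refine (Complex.abs_re_le_norm _).trans (h.trans ?_)
  rw [div_mul_eq_mul_div, mul_comm, ← mul_div_assoc]
  refine div_le_div_of_nonneg_right (mul_le_mul_of_nonneg_left (pow_le_pow_left₀ (abs_nonneg _) htx _) two_pos.le) (by positivity)

/-- **THE MGF'S OF THE TWO ARC FAMILIES ARE CLOSE**: for `2 ≤ n`, `2l₀ ≤ n`, `|t| ≤ l₀`:
`|Σ_{k<n} (−1)^k ∫_{x_{k+1}}^{x_k} e^{tx} dx| ≤ 4·l₀^{n−1}∕(n−1)!` (Taylor polynomial killed by §1, remainder `≤ 2l₀^{n−1}∕(n−1)!` on total length `2`).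
[folklore] -/
theorem abs_alt_sum_integral_exp_le {n : ℕ} {l₀ t : ℝ} (hn2 : 2 ≤ n) (hn : 2 * l₀ ≤ n) (ht : |t| ≤ l₀) :
    |∑ k ∈ range n, (-1 : ℝ) ^ k * ∫ x in node n (k + 1)..node n k, Real.exp (t * x)| ≤
      4 * (l₀ ^ (n - 1) / ((n - 1).factorial : ℝ)) := by
  -- split `e^{tx} = p(x) + r(x)` with `p` the Taylor polynomial of degree `n − 2`
  set B : ℝ := l₀ ^ (n - 1) / ((n - 1).factorial : ℝ) with hB
  have hB0 : 0 ≤ B := by have : 0 ≤ l₀ := (abs_nonneg _).trans ht; positivity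
  have hcont_r : Continuous fun x : ℝ => Real.exp (t * x) - ∑ j ∈ range (n - 1), (t * x) ^ j / (j.factorial : ℝ) :=
    (Real.continuous_exp.comp (continuous_const.mul continuous_id)).sub
      (continuous_finsetSum _ fun j _ => ((continuous_const.mul continuous_id).pow j).div_const _)
  have hsplit : ∀ k : ℕ, ∫ x in node n (k + 1)..node n k, Real.exp (t * x) =
      (∫ x in node n (k + 1)..node n k, ∑ j ∈ range (n - 1), (t ^ j / (j.factorial : ℝ)) * x ^ j) +
        ∫ x in node n (k + 1)..node n k, (Real.exp (t * x) - ∑ j ∈ range (n - 1), (t * x) ^ j / (j.factorial : ℝ)) := by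
    intro k
    rw [← intervalIntegral.integral_add]
    · refine intervalIntegral.integral_congr fun x _ => ?_
      have e : ∑ j ∈ range (n - 1), t ^ j / (j.factorial : ℝ) * x ^ j = ∑ j ∈ range (n - 1), (t * x) ^ j / (j.factorial : ℝ) :=
        Finset.sum_congr rfl fun j _ => by rw [mul_pow]; ring
      simp only [e, add_sub_cancel]
    · exact (continuous_finsetSum _ fun j _ => continuous_const.mul (continuous_pow j)).intervalIntegrable _ _
    · exact hcont_r.intervalIntegrable _ _
  simp_rw [hsplit, mul_add]
  rw [Finset.sum_add_distrib, alt_sum_integral_powSum_eq_zero (d := n - 1) (by omega), zero_add]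
  -- the remainder: each arc contributes at most `L_k · 2B`
  have harc : ∀ k ∈ range n, |(-1 : ℝ) ^ k * ∫ x in node n (k + 1)..node n k,
      (Real.exp (t * x) - ∑ j ∈ range (n - 1), (t * x) ^ j / (j.factorial : ℝ))| ≤ (node n k - node n (k + 1)) * (2 * B) := by
    intro k hk
    have hkn : k < n := Finset.mem_range.1 hk
    have hle : node n (k + 1) ≤ node n k := (node_succ_lt hkn).le
    rw [abs_mul, abs_pow, abs_neg, abs_one, one_pow, one_mul]
    have hbound : ∀ x ∈ Set.uIoc (node n (k + 1)) (node n k),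
        ‖Real.exp (t * x) - ∑ j ∈ range (n - 1), (t * x) ^ j / (j.factorial : ℝ)‖ ≤ 2 * B := by
      intro x hx
      rw [Set.uIoc_of_le hle] at hx
      rw [Real.norm_eq_abs]
      have hx1 : |x| ≤ 1 := by
        have h1 := (node_mem_Icc (n := n) (i := k)).2
        have h2 := (node_mem_Icc (n := n) (i := k + 1)).1
        exact abs_le.2 ⟨by linarith [hx.1], hx.2.trans h1⟩
      exact abs_exp_sub_taylor_le hn (by omega) ht hx1
    have h := intervalIntegral.norm_integral_le_of_norm_le_const hbound
    rw [Real.norm_eq_abs, abs_of_nonneg (sub_nonneg.2 hle)] at h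
    calc _ ≤ 2 * B * (node n k - node n (k + 1)) := h
      _ = (node n k - node n (k + 1)) * (2 * B) := by ring
  calc _ ≤ ∑ k ∈ range n, |(-1 : ℝ) ^ k * ∫ x in node n (k + 1)..node n k,
          (Real.exp (t * x) - ∑ j ∈ range (n - 1), (t * x) ^ j / (j.factorial : ℝ))| := Finset.abs_sum_le_sum_abs _ _
    _ ≤ ∑ k ∈ range n, (node n k - node n (k + 1)) * (2 * B) := Finset.sum_le_sum harc
    _ = 4 * B := by rw [← Finset.sum_mul, sum_arcLength (by omega)]; ring

end Summit.QuantumFields.YangMills.Theorems.BalabanUVNodesN19ChebyshevArcFunctional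

end
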